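import Literature.NumberTheory.Automorphic.UnitaryTwoRamifiedTreeAction   -- ★ B-p08 (g28): the ramified-place kit this file continues (`eq_of_sq_eq_sq`, `exists_valuation_eq_and_norm_eq_one_of_ramified`; imports ★ `toPlace` ∕ `valued_toPlace` ∕ `galAdicCompletionMap` ∕ the `Valued`–`ValuativeRel` bridge ∕ `ramificationIdx'_eq_two_of_ne_one` ∕ `exists_toPlace_eq_of_galAdicCompletionMap_eq`)
import HarnessLib

/-!
# The EISENSTEIN BASIS `(1, ϖ_E)` of `L_w ∕ L⁺_v` at a RAMIFIED CM place: `ϖ_E² = u·ϖ_E + v` with `u ∈ 𝔭_v`, `|v|_v = |ϖ_v|`, and `𝒪[L_w] = 𝒪_v ⊕ 𝒪_v ϖ_E`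
# (Serre, *Local Fields* I §6 Prop. 18; Labesse–Langlands 1979 §2 p. 7)

Topic `NumberTheory/Automorphic`; namespace `Literature.NumberTheory.Automorphic.UnitaryGroup`.  THEOREMS ONLY (no definition, no instance, no notation, no named fact,
no `sorry`; axioms ⊆ {propext, Classical.choice, Quot.sound}).  Cell `pub/hodgecm-mathlib` (D-0151), crux H413 = `stmt-HodgeConjecture-24833`, line «N6nsGerm», ROAD «W′»
(the wildly ramified residue «R1-CM-ram-wild»), architect A-p16 (g28) RULING A-37 FLAG 1 ∕ A-39 ∕ A-42: socket **(W′1-CM0) «THE EISENSTEIN BASIS AT A RAMIFIED CM PLACE»**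
— the DISCHARGE, at a concrete ramified place `w ∣ v` of a CM extension `L ∕ L⁺`, of the three F-side hypotheses `(hu : u ∈ 𝒪) (hu1 : |u| < 1) (hv1 : |v| = |ϖ|)` under which
the tree-side files of the road are typed (A-p01 (g21) census 5e3bce9c §1; A-p17 (g23) ★ `SLTwoTreeQuadraticTorus{FixedShells,ShellDecomposition,ShellIndex,ShellSeam}`
with the non-split ∕ integral-basis binder `hE : |p² + p q u − q² v| ≤ 1 ⇒ p, q ∈ 𝒪`), seat B-p17 (g25).  Consumers: B-p14 (g33) (Ψ1) CM dress, A-p01 (V-INDEX), A-p17 (V-ORBIT).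

SETTING.  `L` a CM field, `v` a finite place of `L⁺`, `w ∣ v` with `c • w = w` (`c` = complex conjugation) and `e(w|v) ≠ 1` (so `e = 2`, `f = 1`); `F := L⁺_v = v.adicCompletion L⁺`,
`E := L_w = w.1.adicCompletion L`, `ι = toPlace v w : F →+* E`, `σ = σ_w = galAdicCompletionMap c hw : E →+* E` (`σ ∘ ι = ι`, `σσ = 1`, `|σ x| = |x|`, `|ι y| = |y|²`);
`τ ∈ E` ANY uniformiser (`Valued.v τ = exp (−1)`).  No condition on the residue characteristic.
* §1 `valued_toPlace_eq_sq_of_ramified` (`|ι y| = |y|²`), `valued_ne_exp_neg_one_of_toPlace` (an element of `ι(F)` never has valuation `exp(−1)`: squares are even),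
  `galAdicCompletionMap_ne_self_of_uniformizer` (`σ τ ≠ τ`).
* §2 **`exists_eisenstein_coeffs_of_ramified`**: `∃ u v : F, τ + σ τ = ι u ∧ τ · σ τ = −ι v ∧ |u| < 1 ∧ |v| = exp(−1)` (descent of the `σ`-fixed trace and norm ★
  `exists_toPlace_eq_of_galAdicCompletionMap_eq`; `|ι u| ≤ |τ| < 1`, `|ι v| = |τ|²`), whence `τ² = ι u · τ + ι v` (`sq_eq_of_trace_norm`) and the A-p01 spelling
  `u ∈ 𝒪[F] ∧ valuation F u < 1 ∧ valuation F v = valuation F ϖ_F` for every uniformiser `ϖ_F` of `F` (`exists_eisenstein_coeffs_of_ramified'`).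
* §3 THE BASIS `(1, τ)`: `exists_eq_toPlace_add_toPlace_mul` (`E = ι F ⊕ ι F·τ`: `q = (x − σx)∕(τ − στ)`, `p = x − qτ` are `σ`-fixed), `valued_toPlace_add_toPlace_mul`
  (`|ι p + ι q τ| = max (|p|², |q|²·|τ|)` — the two values have opposite parity), **`toPlace_add_toPlace_mul_mem_integer_iff`** (`ι p + ι q τ ∈ 𝒪[E] ↔ p, q ∈ 𝒪[F]`: THE
  INTEGRAL BASIS `𝒪[L_w] = 𝒪_v ⊕ 𝒪_v ϖ_E`), the norm identity `toPlace_add_mul_mul_galAdicCompletionMap_eq` (`x · σx = ι (p² + p q u − q² v)`) and A-p17's binder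
  **`quadNormForm_integral_of_ramified`** (`|p² + p q u − q² v| ≤ 1 ⇒ p, q ∈ 𝒪`) at the CM place.
* §4 **`exists_eisensteinBasis_of_ramified`** — ONE `∃ τ u v`-package of all the clauses (for consumers who want a single call).
HONEST LABEL: HC_CM is proved only modulo the cell's 2 remaining named inputs (hLiu418, h413) until rung 0 closes; this file is unconditional local algebra and pays no letter by itself.

## References
* [Serre1979] J.-P. Serre, *Local Fields*, GTM 67 (1979): Ch. I §6 Prop. 18 (a totally ramified extension is generated by a uniformiser satisfying an Eisenstein equation,
  `𝒪_E = 𝒪_F[ϖ_E]`), Ch. II §1–§2.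
* [LabesseLanglands1979] J.-P. Labesse, R. P. Langlands, *L-indistinguishability for SL(2)*, Canad. J. Math. 31 (1979): §2 p. 7 (the torus `a + bτ` on the tree).
* [NeukirchANT1999] J. Neukirch, *Algebraic Number Theory* (1999): Ch. II (6.8)–(6.9) (local degree `= e·f`).
-/

set_option autoImplicit false

noncomputable section

open NumberField IsDedekindDomain ValuativeRel
open scoped ValuativeRel WithZero

namespace Literature.NumberTheory.Automorphic.UnitaryGroup

variable (L : Type) [Field L] [NumberField L] [IsCMField L] (v : HeightOneSpectrum (𝓞 ↥(maximalRealSubfield L)))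
  (w : PlacesOver L v) (hw : IsCMField.complexConj L • w.1 = w.1) (he : v.asIdeal.ramificationIdx' w.1.asIdeal ≠ 1)

/-! ## §1 Valuations at a ramified place: `|ι y| = |y|²`, so no element of `ι(L⁺_v)` is a uniformiser of `L_w` -/

include hw he in
/-- `|ι_w y|_w = |y|_v²` at a ramified place (`e(w|v) = 2`, ★ `valued_toPlace`). [cite: NeukirchANT1999, Ch. II (6.8)–(6.9)] -/
theorem valued_toPlace_eq_sq_of_ramified (y : v.adicCompletion ↥(maximalRealSubfield L)) :
    Valued.v (toPlace v w y) = Valued.v y ^ 2 := by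
  rw [valued_toPlace, Liu2021.LemD1IndexedNonVacuityRamifiedPlace.ramificationIdx'_eq_two_of_ne_one L v (IsCMField.complexConj L)
    (IsCMField.complexConj_ne_one L) w hw he]

include hw he in
/-- **Squares are even**: no element of `ι_w(L⁺_v)` has valuation `exp(−1)` (the value `|ι y| = |y|²` is `0` or an even power). [cite: Serre1979, Ch. II §2] -/
theorem valued_toPlace_ne_exp_neg_one (y : v.adicCompletion ↥(maximalRealSubfield L)) :
    Valued.v (toPlace v w y) ≠ WithZero.exp (-1 : ℤ) := by
  rw [valued_toPlace_eq_sq_of_ramified L v w hw he]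
  intro h
  rcases eq_or_ne (Valued.v y) 0 with h0 | h0
  · rw [h0, zero_pow two_ne_zero] at h
    exact WithZero.zero_ne_coe h
  · obtain ⟨m, hm⟩ : ∃ m : ℤ, Valued.v y = WithZero.exp m := ⟨_, (WithZero.exp_log h0).symm⟩
    rw [hm, ← WithZero.exp_nsmul, WithZero.exp_inj] at h
    simp only [nsmul_eq_mul, Nat.cast_ofNat] at h
    omega

include he in
/-- **A uniformiser of `L_w` is not `σ_w`-fixed** at a ramified place (a `σ_w`-fixed element descends to `L⁺_v` by ★ `exists_toPlace_eq_of_galAdicCompletionMap_eq`, and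
then its valuation would be a square). [cite: Serre1979, Ch. I §6 Prop. 18] -/
theorem galAdicCompletionMap_ne_self_of_uniformizer {τ : w.1.adicCompletion L} (hτ : Valued.v τ = WithZero.exp (-1 : ℤ)) :
    galAdicCompletionMap (L := L) (IsCMField.complexConj L) hw τ ≠ τ := by
  intro hfix
  obtain ⟨p, hp⟩ := exists_toPlace_eq_of_galAdicCompletionMap_eq (IsCMField.complexConj L) w (IsCMField.complexConj_ne_one L) hw τ hfix
  exact valued_toPlace_ne_exp_neg_one L v w hw he p (by rw [hp, hτ])

/-! ## §2 The Eisenstein coefficients `u = τ + στ ∈ 𝔭_v`, `v = −τ·στ`, `|v|_v = |ϖ_v|` -/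

include he in
/-- **THE EISENSTEIN COEFFICIENTS OF A UNIFORMISER.**  At a ramified CM place, for ANY uniformiser `τ` of `L_w` there are `u v ∈ L⁺_v` with `τ + σ_w τ = ι u`,
`τ · σ_w τ = −ι v`, `|u|_v < 1` and `|v|_v = exp(−1)` (so `v` is a uniformiser of `L⁺_v`): the trace and the norm are `σ_w`-fixed, hence descend (★
`exists_toPlace_eq_of_galAdicCompletionMap_eq`); `|ι u| ≤ |τ| < 1` and `|ι v| = |τ|² = exp(−2)` together with `|ι y| = |y|²`.
[cite: Serre1979, Ch. I §6 Prop. 18] [cite: LabesseLanglands1979, §2 p. 7] -/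
theorem exists_eisenstein_coeffs_of_ramified {τ : w.1.adicCompletion L} (hτ : Valued.v τ = WithZero.exp (-1 : ℤ)) :
    ∃ u₀ v₀ : v.adicCompletion ↥(maximalRealSubfield L),
      τ + galAdicCompletionMap (L := L) (IsCMField.complexConj L) hw τ = toPlace v w u₀ ∧
      τ * galAdicCompletionMap (L := L) (IsCMField.complexConj L) hw τ = -toPlace v w v₀ ∧
      Valued.v u₀ < 1 ∧ Valued.v v₀ = WithZero.exp (-1 : ℤ) := by
  have hc1 : IsCMField.complexConj L ≠ 1 := IsCMField.complexConj_ne_one L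
  have hσσ : ∀ x, galAdicCompletionMap (L := L) (IsCMField.complexConj L) hw (galAdicCompletionMap (L := L) (IsCMField.complexConj L) hw x) = x :=
    galAdicCompletionMap_galAdicCompletionMap_of_smul_eq (IsCMField.complexConj L) w hc1 hw
  -- the trace and the norm are `σ`-fixed
  have htr : galAdicCompletionMap (L := L) (IsCMField.complexConj L) hw (τ + galAdicCompletionMap (L := L) (IsCMField.complexConj L) hw τ) =
      τ + galAdicCompletionMap (L := L) (IsCMField.complexConj L) hw τ := by
    rw [map_add, hσσ, add_comm]
  have hnm : galAdicCompletionMap (L := L) (IsCMField.complexConj L) hw (-(τ * galAdicCompletionMap (L := L) (IsCMField.complexConj L) hw τ)) =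
      -(τ * galAdicCompletionMap (L := L) (IsCMField.complexConj L) hw τ) := by
    rw [map_neg, map_mul, hσσ, mul_comm]
  obtain ⟨u₀, hu⟩ := exists_toPlace_eq_of_galAdicCompletionMap_eq (IsCMField.complexConj L) w hc1 hw _ htr
  obtain ⟨v₀, hv'⟩ := exists_toPlace_eq_of_galAdicCompletionMap_eq (IsCMField.complexConj L) w hc1 hw _ hnm
  refine ⟨u₀, v₀, hu.symm, by rw [hv', neg_neg], ?_, ?_⟩
  · -- `|u₀|² = |ι u₀| = |τ + στ| ≤ exp(-1) < 1`
    have h1 : Valued.v (toPlace v w u₀) < 1 := by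
      rw [hu]
      refine lt_of_le_of_lt (Valuation.map_add _ _ _) ?_
      rw [valued_galAdicCompletionMap, hτ, max_self, ← WithZero.exp_zero, WithZero.exp_lt_exp]
      norm_num
    rw [valued_toPlace_eq_sq_of_ramified L v w hw he] at h1
    by_contra hge
    rw [not_lt] at hge
    have h2 := mul_le_mul' hge hge
    rw [one_mul, ← pow_two] at h2
    exact absurd h1 (not_lt.2 h2)
  · -- `|v₀|² = |ι v₀| = |τ|·|στ| = exp(-1)²`
    have h2 : Valued.v (toPlace v w v₀) = WithZero.exp (-1 : ℤ) ^ 2 := by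
      rw [hv', Valuation.map_neg, map_mul, valued_galAdicCompletionMap, hτ, pow_two]
    rw [valued_toPlace_eq_sq_of_ramified L v w hw he] at h2
    exact eq_of_sq_eq_sq h2

/-- The Eisenstein equation from trace and norm: `τ + στ = U`, `τ·στ = −V` ⇒ `τ² = U τ + V`. [cite: Serre1979, Ch. I §6 Prop. 18] -/
theorem sq_eq_of_trace_norm {K : Type*} [CommRing K] {τ στ U V : K} (htr : τ + στ = U) (hnm : τ * στ = -V) : τ ^ 2 = U * τ + V := by
  have h1 : στ = U - τ := by linear_combination htr
  rw [h1] at hnm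
  linear_combination -hnm

include he in
/-- **THE EISENSTEIN COEFFICIENTS IN THE F-SIDE SPELLING OF THE ROAD** (A-p01 (g21) census 5e3bce9c §1 ∕ A-p17 (g23) ★ `SLTwoTreeQuadraticTorus*`): for any uniformiser `τ`
of `L_w` and any uniformiser `ϖ_F` of `L⁺_v` there are `u v ∈ L⁺_v` with `τ² = ι u · τ + ι v`, `τ + σ_w τ = ι u`, `τ · σ_w τ = −ι v`, and EXACTLY the three hypotheses
`(hu : u ∈ 𝒪[L⁺_v]) (hu1 : valuation L⁺_v u < 1) (hv1 : valuation L⁺_v v = valuation L⁺_v ϖ_F)` (the `ValuativeRel` currency, via ★ `v_le_one_iff_mem_integer`,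
`v_lt_one_iff_valuation_lt_one`, `v_eq_iff_valuation_eq`). [cite: Serre1979, Ch. I §6 Prop. 18] [cite: LabesseLanglands1979, §2 p. 7] -/
theorem exists_eisenstein_coeffs_of_ramified' {ϖF : v.adicCompletion ↥(maximalRealSubfield L)} (hϖF : Valued.v ϖF = WithZero.exp (-1 : ℤ))
    {τ : w.1.adicCompletion L} (hτ : Valued.v τ = WithZero.exp (-1 : ℤ)) :
    ∃ u₀ v₀ : v.adicCompletion ↥(maximalRealSubfield L),
      τ ^ 2 = toPlace v w u₀ * τ + toPlace v w v₀ ∧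
      τ + galAdicCompletionMap (L := L) (IsCMField.complexConj L) hw τ = toPlace v w u₀ ∧
      τ * galAdicCompletionMap (L := L) (IsCMField.complexConj L) hw τ = -toPlace v w v₀ ∧
      u₀ ∈ 𝒪[v.adicCompletion ↥(maximalRealSubfield L)] ∧
      valuation (v.adicCompletion ↥(maximalRealSubfield L)) u₀ < 1 ∧
      valuation (v.adicCompletion ↥(maximalRealSubfield L)) v₀ = valuation (v.adicCompletion ↥(maximalRealSubfield L)) ϖF := by
  obtain ⟨u₀, v₀, htr, hnm, hu1, hv1⟩ := exists_eisenstein_coeffs_of_ramified L v w hw he hτ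
  refine ⟨u₀, v₀, sq_eq_of_trace_norm htr hnm, htr, hnm, ?_, ?_, ?_⟩
  · exact (v_le_one_iff_mem_integer u₀).1 hu1.le
  · exact (v_lt_one_iff_valuation_lt_one u₀).1 hu1
  · exact (v_eq_iff_valuation_eq v₀ ϖF).1 (hv1.trans hϖF.symm)

/-! ## §3 The basis `(1, τ)`: `L_w = ι L⁺_v ⊕ ι L⁺_v · τ` and `𝒪[L_w] = 𝒪_v ⊕ 𝒪_v τ` -/

include hw he in
/-- **`(1, τ)` SPANS `L_w` OVER `ι(L⁺_v)`**: every `x ∈ L_w` is `ι p + ι q · τ` — `q = (x − σx)∕(τ − στ)` and `p = x − q τ` are `σ`-fixed, hence descend; `τ ≠ στ`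
by §1. [cite: Serre1979, Ch. I §6 Prop. 18] [cite: NeukirchANT1999, Ch. II (6.8)–(6.9)] -/
theorem exists_eq_toPlace_add_toPlace_mul {τ : w.1.adicCompletion L} (hτ : Valued.v τ = WithZero.exp (-1 : ℤ)) (x : w.1.adicCompletion L) :
    ∃ p q : v.adicCompletion ↥(maximalRealSubfield L), x = toPlace v w p + toPlace v w q * τ := by
  have hc1 : IsCMField.complexConj L ≠ 1 := IsCMField.complexConj_ne_one L
  have hσσ : ∀ y, galAdicCompletionMap (L := L) (IsCMField.complexConj L) hw (galAdicCompletionMap (L := L) (IsCMField.complexConj L) hw y) = y :=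
    galAdicCompletionMap_galAdicCompletionMap_of_smul_eq (IsCMField.complexConj L) w hc1 hw
  have hσι : ∀ y, galAdicCompletionMap (L := L) (IsCMField.complexConj L) hw (toPlace v w y) = toPlace v w y :=
    fun y => galAdicCompletionMap_toPlace (IsCMField.complexConj L) w w hw y
  have hδ : τ - galAdicCompletionMap (L := L) (IsCMField.complexConj L) hw τ ≠ 0 :=
    fun h => galAdicCompletionMap_ne_self_of_uniformizer L v w hw he hτ (sub_eq_zero.1 h).symm
  -- `q₀ = (x - σx)/(τ - στ)` is `σ`-fixed
  obtain ⟨q₀, hq₀⟩ : ∃ q₀ : w.1.adicCompletion L, q₀ = (x - galAdicCompletionMap (L := L) (IsCMField.complexConj L) hw x) *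
      (τ - galAdicCompletionMap (L := L) (IsCMField.complexConj L) hw τ)⁻¹ := ⟨_, rfl⟩
  have hq₀fix : galAdicCompletionMap (L := L) (IsCMField.complexConj L) hw q₀ = q₀ := by
    rw [hq₀, map_mul, map_inv₀, map_sub, map_sub, hσσ, hσσ, ← neg_sub x, ← neg_sub τ, inv_neg, neg_mul_neg]
  obtain ⟨q, hq⟩ := exists_toPlace_eq_of_galAdicCompletionMap_eq (IsCMField.complexConj L) w hc1 hw q₀ hq₀fix
  -- `p₀ = x - q₀ τ` is `σ`-fixed
  have hp₀fix : galAdicCompletionMap (L := L) (IsCMField.complexConj L) hw (x - q₀ * τ) = x - q₀ * τ := by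
    have key : x - galAdicCompletionMap (L := L) (IsCMField.complexConj L) hw x =
        q₀ * (τ - galAdicCompletionMap (L := L) (IsCMField.complexConj L) hw τ) := by
      rw [hq₀, inv_mul_cancel_right₀ hδ]
    rw [map_sub, map_mul, hq₀fix]
    linear_combination -key
  obtain ⟨p, hp⟩ := exists_toPlace_eq_of_galAdicCompletionMap_eq (IsCMField.complexConj L) w hc1 hw _ hp₀fix
  exact ⟨p, q, by rw [hp, hq]; ring⟩

include hw he in
/-- **The valuation of `ι p + ι q τ` is the LARGER of `|p|²` and `|q|²·|τ|`** (the two values have opposite parity, so the ultrametric inequality is an equality).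
[cite: Serre1979, Ch. II §2] -/
theorem valued_toPlace_add_toPlace_mul {τ : w.1.adicCompletion L} (hτ : Valued.v τ = WithZero.exp (-1 : ℤ)) (p q : v.adicCompletion ↥(maximalRealSubfield L)) :
    Valued.v (toPlace v w p + toPlace v w q * τ) = max (Valued.v p ^ 2) (Valued.v q ^ 2 * WithZero.exp (-1 : ℤ)) := by
  have hp2 : Valued.v (toPlace v w p) = Valued.v p ^ 2 := valued_toPlace_eq_sq_of_ramified L v w hw he p
  have hq2 : Valued.v (toPlace v w q * τ) = Valued.v q ^ 2 * WithZero.exp (-1 : ℤ) := by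
    rw [map_mul, valued_toPlace_eq_sq_of_ramified L v w hw he q, hτ]
  rcases eq_or_ne q 0 with hq0 | hq0
  · rw [hq0, map_zero, zero_mul, add_zero, hp2, map_zero, zero_pow two_ne_zero, zero_mul, max_eq_left zero_le]
  rcases eq_or_ne p 0 with hp0 | hp0
  · rw [hp0, map_zero, zero_add, hq2, map_zero, zero_pow two_ne_zero, max_eq_right zero_le]
  -- both non-zero: the values differ (parity), so `v (a + b) = max`
  have hne : Valued.v (toPlace v w p) ≠ Valued.v (toPlace v w q * τ) := by
    rw [hp2, hq2]
    obtain ⟨m, hm⟩ : ∃ m : ℤ, Valued.v p = WithZero.exp m := ⟨_, (WithZero.exp_log ((Valuation.ne_zero_iff _).2 hp0)).symm⟩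
    obtain ⟨n, hn⟩ : ∃ n : ℤ, Valued.v q = WithZero.exp n := ⟨_, (WithZero.exp_log ((Valuation.ne_zero_iff _).2 hq0)).symm⟩
    rw [hm, hn, ← WithZero.exp_nsmul, ← WithZero.exp_nsmul, ← WithZero.exp_add, Ne, WithZero.exp_inj]
    simp only [nsmul_eq_mul, Nat.cast_ofNat]
    omega
  rw [Valuation.map_add_of_distinct_val _ hne, hp2, hq2]

/-- In `ℤᵐ⁰`: `x² ≤ 1 ↔ x ≤ 1`. [cite: Serre1979, Ch. II §1] -/
theorem sq_le_one_iff_withZero (x : WithZero (Multiplicative ℤ)) : x ^ 2 ≤ 1 ↔ x ≤ 1 := by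
  rcases eq_or_ne x 0 with h0 | h0
  · simp [h0]
  obtain ⟨m, hm⟩ : ∃ m : ℤ, x = WithZero.exp m := ⟨_, (WithZero.exp_log h0).symm⟩
  rw [hm, ← WithZero.exp_nsmul, ← WithZero.exp_zero, WithZero.exp_le_exp, WithZero.exp_le_exp]
  simp only [nsmul_eq_mul, Nat.cast_ofNat]
  omega

/-- In `ℤᵐ⁰`: `x² · exp(−1) ≤ 1 ↔ x ≤ 1` (an even exponent minus one is `≤ 0` iff the exponent is `≤ 0`). [cite: Serre1979, Ch. II §1] -/
theorem sq_mul_exp_neg_one_le_one_iff (x : WithZero (Multiplicative ℤ)) : x ^ 2 * WithZero.exp (-1 : ℤ) ≤ 1 ↔ x ≤ 1 := by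
  rcases eq_or_ne x 0 with h0 | h0
  · simp [h0]
  obtain ⟨m, hm⟩ : ∃ m : ℤ, x = WithZero.exp m := ⟨_, (WithZero.exp_log h0).symm⟩
  rw [hm, ← WithZero.exp_nsmul, ← WithZero.exp_add, ← WithZero.exp_zero, WithZero.exp_le_exp, WithZero.exp_le_exp]
  simp only [nsmul_eq_mul, Nat.cast_ofNat]
  omega

include hw he in
/-- **THE INTEGRAL BASIS `𝒪[L_w] = 𝒪_v ⊕ 𝒪_v · ϖ_E`**: `ι p + ι q τ` is integral iff `p` and `q` are (valuations: `max (|p|², |q|²|τ|) ≤ 1` iff `|p| ≤ 1` and `|q| ≤ 1`).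
[cite: Serre1979, Ch. I §6 Prop. 18] -/
theorem toPlace_add_toPlace_mul_mem_integer_iff {τ : w.1.adicCompletion L} (hτ : Valued.v τ = WithZero.exp (-1 : ℤ))
    (p q : v.adicCompletion ↥(maximalRealSubfield L)) :
    toPlace v w p + toPlace v w q * τ ∈ 𝒪[w.1.adicCompletion L] ↔
      p ∈ 𝒪[v.adicCompletion ↥(maximalRealSubfield L)] ∧ q ∈ 𝒪[v.adicCompletion ↥(maximalRealSubfield L)] := by
  rw [← v_le_one_iff_mem_integer, ← v_le_one_iff_mem_integer, ← v_le_one_iff_mem_integer, valued_toPlace_add_toPlace_mul L v w hw he hτ,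
    max_le_iff, sq_le_one_iff_withZero, sq_mul_exp_neg_one_le_one_iff]

/-- `σ_w (ι p + ι q τ) = ι p + ι q · σ_w τ` (`σ_w` fixes `ι`, ★ `galAdicCompletionMap_toPlace`). [cite: LabesseLanglands1979, §2 p. 7] -/
theorem galAdicCompletionMap_toPlace_add_toPlace_mul (τ : w.1.adicCompletion L) (p q : v.adicCompletion ↥(maximalRealSubfield L)) :
    galAdicCompletionMap (L := L) (IsCMField.complexConj L) hw (toPlace v w p + toPlace v w q * τ) =
      toPlace v w p + toPlace v w q * galAdicCompletionMap (L := L) (IsCMField.complexConj L) hw τ := by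
  rw [map_add, map_mul, galAdicCompletionMap_toPlace (IsCMField.complexConj L) w w hw p, galAdicCompletionMap_toPlace (IsCMField.complexConj L) w w hw q]

/-- **THE NORM FORM IN THE EISENSTEIN BASIS**: with `τ + στ = ι u`, `τ·στ = −ι v`, `(ι p + ι q τ)·σ(ι p + ι q τ) = ι (p² + p q u − q² v)` (LL79's `N(a + bτ)`).
[cite: LabesseLanglands1979, §2 p. 7] -/
theorem toPlace_add_mul_mul_galAdicCompletionMap_eq {τ : w.1.adicCompletion L} {u v' : v.adicCompletion ↥(maximalRealSubfield L)}
    (htr : τ + galAdicCompletionMap (L := L) (IsCMField.complexConj L) hw τ = toPlace v w u)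
    (hnm : τ * galAdicCompletionMap (L := L) (IsCMField.complexConj L) hw τ = -toPlace v w v') (p q : v.adicCompletion ↥(maximalRealSubfield L)) :
    (toPlace v w p + toPlace v w q * τ) * galAdicCompletionMap (L := L) (IsCMField.complexConj L) hw (toPlace v w p + toPlace v w q * τ) =
      toPlace v w (p ^ 2 + p * q * u - q ^ 2 * v') := by
  rw [galAdicCompletionMap_toPlace_add_toPlace_mul L v w hw τ p q, map_sub, map_add, map_pow, map_mul, map_mul, map_mul, map_pow, ← htr]
  linear_combination (toPlace v w q) ^ 2 * hnm

include he in
/-- **A-p17's NON-SPLIT ∕ INTEGRAL-BASIS BINDER `hE` AT THE CM PLACE**: with `u, v` the Eisenstein coefficients of a uniformiser `τ`, `|p² + p q u − q² v|_v ≤ 1` forces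
`p, q ∈ 𝒪_v` (the norm of `x = ι p + ι q τ` has valuation `|x|²`, so `x` is integral, and §3). [cite: LabesseLanglands1979, §2 p. 7] [cite: Serre1979, Ch. I §6 Prop. 18] -/
theorem quadNormForm_integral_of_ramified {τ : w.1.adicCompletion L} (hτ : Valued.v τ = WithZero.exp (-1 : ℤ)) {u v' : v.adicCompletion ↥(maximalRealSubfield L)}
    (htr : τ + galAdicCompletionMap (L := L) (IsCMField.complexConj L) hw τ = toPlace v w u)
    (hnm : τ * galAdicCompletionMap (L := L) (IsCMField.complexConj L) hw τ = -toPlace v w v') :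
    ∀ p q : v.adicCompletion ↥(maximalRealSubfield L),
      valuation (v.adicCompletion ↥(maximalRealSubfield L)) (p ^ 2 + p * q * u - q ^ 2 * v') ≤ 1 →
        p ∈ 𝒪[v.adicCompletion ↥(maximalRealSubfield L)] ∧ q ∈ 𝒪[v.adicCompletion ↥(maximalRealSubfield L)] := by
  intro p q h
  rw [← v_le_one_iff_valuation_le_one] at h
  have h2 : Valued.v (toPlace v w (p ^ 2 + p * q * u - q ^ 2 * v')) ≤ 1 := by
    rw [valued_toPlace_eq_sq_of_ramified L v w hw he, pow_two]
    have h' := mul_le_mul' h h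
    rwa [one_mul] at h'
  rw [← toPlace_add_mul_mul_galAdicCompletionMap_eq L v w hw htr hnm, map_mul, valued_galAdicCompletionMap, ← pow_two, sq_le_one_iff_withZero,
    v_le_one_iff_mem_integer] at h2
  exact (toPlace_add_toPlace_mul_mem_integer_iff L v w hw he hτ p q).1 h2

/-! ## §4 The package -/

include he in
/-- **(W′1-CM0) THE EISENSTEIN BASIS AT A RAMIFIED CM PLACE — ONE PACKAGE.**  At a ramified place `w ∣ v` of the CM extension `L ∕ L⁺` (any residue characteristic) and for any
uniformiser `ϖ_F` of `L⁺_v`: there are a uniformiser `τ` of `L_w` and `u v ∈ L⁺_v` with `τ² = ι u · τ + ι v` (`τ + σ_w τ = ι u`, `τ · σ_w τ = −ι v`), EXACTLY the road's three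
F-side hypotheses `u ∈ 𝒪`, `valuation u < 1`, `valuation v = valuation ϖ_F` (A-p01 (g21) §1), the basis property `L_w = ι L⁺_v ⊕ ι L⁺_v · τ`, THE INTEGRAL BASIS
`ι p + ι q τ ∈ 𝒪[L_w] ↔ p, q ∈ 𝒪_v`, and A-p17 (g23)'s binder `hE`. [cite: Serre1979, Ch. I §6 Prop. 18] [cite: LabesseLanglands1979, §2 p. 7] [cite: NeukirchANT1999, Ch. II (6.8)–(6.9)] -/
theorem exists_eisensteinBasis_of_ramified {ϖF : v.adicCompletion ↥(maximalRealSubfield L)} (hϖF : Valued.v ϖF = WithZero.exp (-1 : ℤ)) :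
    ∃ (τ : w.1.adicCompletion L) (u v' : v.adicCompletion ↥(maximalRealSubfield L)),
      Valued.v τ = WithZero.exp (-1 : ℤ) ∧
      τ ^ 2 = toPlace v w u * τ + toPlace v w v' ∧
      τ + galAdicCompletionMap (L := L) (IsCMField.complexConj L) hw τ = toPlace v w u ∧
      τ * galAdicCompletionMap (L := L) (IsCMField.complexConj L) hw τ = -toPlace v w v' ∧
      u ∈ 𝒪[v.adicCompletion ↥(maximalRealSubfield L)] ∧
      valuation (v.adicCompletion ↥(maximalRealSubfield L)) u < 1 ∧
      valuation (v.adicCompletion ↥(maximalRealSubfield L)) v' = valuation (v.adicCompletion ↥(maximalRealSubfield L)) ϖF ∧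
      (∀ x : w.1.adicCompletion L, ∃ p q : v.adicCompletion ↥(maximalRealSubfield L), x = toPlace v w p + toPlace v w q * τ) ∧
      (∀ p q : v.adicCompletion ↥(maximalRealSubfield L),
        toPlace v w p + toPlace v w q * τ ∈ 𝒪[w.1.adicCompletion L] ↔
          p ∈ 𝒪[v.adicCompletion ↥(maximalRealSubfield L)] ∧ q ∈ 𝒪[v.adicCompletion ↥(maximalRealSubfield L)]) ∧
      (∀ p q : v.adicCompletion ↥(maximalRealSubfield L),
        valuation (v.adicCompletion ↥(maximalRealSubfield L)) (p ^ 2 + p * q * u - q ^ 2 * v') ≤ 1 →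
          p ∈ 𝒪[v.adicCompletion ↥(maximalRealSubfield L)] ∧ q ∈ 𝒪[v.adicCompletion ↥(maximalRealSubfield L)]) := by
  -- a uniformiser of `L_w`
  obtain ⟨π, hπ⟩ := w.1.valuation_exists_uniformizer L
  have hτ : Valued.v (π : w.1.adicCompletion L) = WithZero.exp (-1 : ℤ) := by rw [HeightOneSpectrum.valuedAdicCompletion_eq_valuation', hπ]
  obtain ⟨u, v', hsq, htr, hnm, hu, hu1, hv1⟩ := exists_eisenstein_coeffs_of_ramified' L v w hw he hϖF hτ
  exact ⟨(π : w.1.adicCompletion L), u, v', hτ, hsq, htr, hnm, hu, hu1, hv1, exists_eq_toPlace_add_toPlace_mul L v w hw he hτ,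
    toPlace_add_toPlace_mul_mem_integer_iff L v w hw he hτ, quadNormForm_integral_of_ramified L v w hw he hτ htr hnm⟩

end Literature.NumberTheory.Automorphic.UnitaryGroup

end
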